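import Summits.QuantumFields.BalabanUV.Beta.CombSecondOrderRemainderAn1

/-!
# `BalabanUV.Beta.CombSecondOrderRemainderAn1Scaled` — binder row D1, chart (III″) (RULING R-D1-g56-4, W-3 [AN2-G56-W3] programme (S)∕(D5)): **THE κ-TWIN OF
# `CombSecondOrderRemainderAn1`** — the second-order remainder `combR2An1W`, the split defect `combΔOfAtW`∕`combΔAn1W` of the (III″) κ-literal and their three
# by-construction letters `hR2succ_combW` ∕ `hsplit_combW` ∕ `h0_combW` (the binders `R2 ∕ h0 ∕ Δ ∕ hsplit ∕ hR2succ` of the chain root MWVB, re-instantiated)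

HONEST FRAMING (cell contract, verbatim): «discharging `BetaPertH` makes Bałaban's UV stability UNCONDITIONAL — a real constructive-QFT
result; it is NOT the continuum limit and NOT the Clay problem.»  THIS MODULE DISCHARGES NOTHING of `BetaPertH` ∕ row D1.  Three [our object]
bookkeeping definitions over OUR typed objects and three [folklore] identities that hold BY CONSTRUCTION (`rfl`, `add_sub_cancel`, an involution);
0 sorry, 0 `def … : Prop`, nothing cited as a fact, no table VALUE, NO pin value (`cΛ`, `w` are parameters), no lock.  NOT D1, NOT BetaPertH, NOT
continuum, NOT Clay.

WHY (row D1 ∕ (C1) OWNER an2 g56: RULING R-D1-g56-4 (4-2), SPEC (III″) v1.0 + A-1, W-3 (S)∕(D5) «OPEN FOR OFFERS»; leaf-04 g33 census N-1 `CENSUS-M3CONE-g33.md`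
327a4d2f37f5525f §B∕§C): the (III″) literal is ROOT M‴'s comb literal with its Λ group carried at ONE weight `κ` — mixed table `κ • symMixFFAt ρ_c Lc`
(= `(SymTablesAn1S2Weighted.symTablesAn1S2w 3 Lc (κ·cΛ) κ).mixFF` by term), multiplier∕first-order pin `κ·cΛ`, mixed reflection remainder
`κ • symRMrAn1 Lc cΛ γ` (`SymLamGroupScaling.hM2_smul_symMixFFAt`), `γ` and the border∕Wilson data untouched.  The chain root MWVB
(`CombChartJointEndReflTablesAn1S2MWVB`) takes the second-order remainder `R2`, the split defect `Δ` and their letters `h0 ∕ hsplit ∕ hR2succ` as BINDERS;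
the (III′) chain's R step supplies them from `CombSecondOrderRemainderAn1` (`combR2An1`, `combΔAn1`, by construction).  THIS FILE is that supply for the
κ-literal: the SAME three definitions with EXACTLY three substitutions — `symMixFFAt (ctr 4 Lc) Lc ↦ w • symMixFFAt (ctr 4 Lc) Lc`,
`cΛ ↦ w·cΛ` in every `SpureRecOf … cΛ` ∕ `M1Of … cΛ` slot, `symRMrAn1 Lc cΛ γ ↦ w • symRMrAn1 Lc cΛ γ` — here the weight is written `w` (the programme's `κ`;
`κ` is a bound bond index in these terms).  LOCATED NOTE: `combR2An1W` is NOT `w •` the landed `combR2An1` — the pure stencil `SpureRecOf … (w·cΛ) (j+1)` is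
AFFINE in `w` (Wilson∕VH part + Λ part through the folded `SrecOf`), `hR2succ`'s word `conjV (mmRead Lc (GcombSh Lc j)) (diagK (… − wVH_{j+1}·(γ ctGenM)(γ ctGenM)))`
is `w`-free, and `dM G (Spure (w·cΛ)) (M1Of (w·cΛ))` mixes degrees; so the P6 class induction and the P5 parity induction are RE-RUN over these objects
(twins of `CombSecondOrderClass{Step,Base}`, `CombSecondOrderDeltaSep`, later `CombLevelZeroT2Law` ∕ `CombRemainderTadpoleSlot` ∕ `CombRemainderParityAll`),
summand by summand with the same pin-generic ∕ Λ-linear letters.  At `w = 1` every object here is the landed one (`one_smul`, `one_mul`).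

WHAT:
* §1 [our object] `combΔOfAtW Lc N cΛ w γ X2s j Rj`, `combR2An1W Lc N cΛ w γ X2s : ℕ → …` (level 0 from `h0`, level `j+1` from `hR2succ`), `combΔAn1W`.
* §2 [folklore] `hR2succ_combW` (`rfl`), `hsplit_combW` (`add_sub_cancel`), `h0_combW` (`refK_Φ_refK_Φ` + `reflSign_mul_self`) — the binder shapes of MWVB's
  root `d1Drift_JsB12CombShSym_an1TablesS2_of_level0ReflLetter_split_D1Tel_D1Rep_of_locks` (its `R2 ∕ h0 ∕ Δ ∕ hsplit ∕ hR2succ`) at the κ-literal, i.e. with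
  the mixed slot `fun κ u ρ t => M2Of 3 Lc (w • symMixFFAt ρ_c Lc) j κ u ρ t + conjV (M1Of 3 Lc (symHessFFAt ρ_c Lc) (w·cΛ) j ρ t) (diagK (γ_j·ctGenM …)) + w • symRMrAn1 Lc cΛ γ j α κ u ρ t`.
NOT HERE: the κ-chain roots (S2w … Nw), the localisation classes of these objects (`CombSecondOrderClass{Step,Base}Scaled`, `CombSecondOrderDeltaSepScaled`),
the parity∕tadpole files, the (III″) root and its display corollary (`κ = Lc¹²∕4` — the OWNER's), any edit of ROOT M‴ p325680 or of the parent.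
HONEST DEPENDENCY (verbatim): «continuum YM on T⁴ ⇐ BetaPertH ∧ nine spine estimates (0/9 proved); BetaPertH ⇐ (D1) ∧ (D4) ∧ CAP+tail;
G-an2-4 gates asym, D1 and NE2/3/4.»  ABSOLUTE RULE (cell, verbatim): «No internally-minted statement may enter as a cited fact. Every
hypothesis is either kernel-proved in this package or a verbatim quotation of a PUBLISHED theorem with page reference.»
Provenance: β sub-cell, D1 formalisation swarm leaf prover 03 (`b2b-balaban-beta-d1-formalise-leaf-03` gen 50), 2026-08-25 (v1; OFFER O-g50-1 «LOC-TAIL-κ» P1,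
zero weight until the row OWNER's word); imports the parent `CombSecondOrderRemainderAn1` (for §3); the text of an2 g36∕37's `CombSecondOrderRemainderAn1` (itself the comb transform of `SymSecondOrderRemainderAn1`)
with the three (S) substitutions; `symMixFFAt` ∕ `symRMrAn1` ∕ `symVh₂SAn1` ∕ `symVhSAt` ∕ `symHessFFAt` (an1 lineage) consumed BY NAME; no existing file touched.
-/

noncomputable section

open Finset
open scoped BigOperators
open Literature.Probability.LatticeModels (Torus.proj)
open Literature.MathematicalPhysics.QuantumFieldTheory
open Literature.MathematicalPhysics.QuantumFieldTheory.Balaban1983to89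
open Literature.MathematicalPhysics.QuantumFieldTheory.Balaban1983to89.Beta
open Literature.MathematicalPhysics.QuantumFieldTheory.Balaban1983to89.Beta.VectorTailsLoc (fam kfam)
open Literature.MathematicalPhysics.QuantumFieldTheory.Balaban1983to89.Beta.VectorLegVolumeAdapter (MvE)
open ExpKernelCalculus (MKer BiLoc VertexFamily comp tr tadpole shiftK)
open PolarizationSign (reflSign WardTransversal AxisReflectionCovariant)
open KernelReflection (refK)
open ResolventReflection (bref Φ)
open AffineAveraging (box toSite)
open AveragingContoursRooted (ctr ctrOff ctrOff_mem_box)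
open OneStepResolventKernel (Fib LocStencil JetData)
open OneStepKernelFamily (KInvStep colH vertexOfK TbalOf flipK D1Tel D1Rep D1Drift)
open KernelWard (divV divW)
open StepJetData (mfNeg wilsonA)
open BalabanStepJetsSucc (mmRead wE wVH)
open SecondOrderResponse (dM W2OfK LocStencilFM)
open BalabanCompositeJets (LocStencil₂)
open BalabanStepW2 (M2Of wB2 wV4)
open WilsonBiStencil (wilsonW₂)
open WilsonVertex2Sym (wsym22)
open Summit.QuantumFields.BalabanUV.Beta.TameKernelCalculus
open Summit.QuantumFields.BalabanUV.Beta.ChartConjugation (conjV conjW)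
open Summit.QuantumFields.BalabanUV.Beta.ChartConjugationDefectEnd (conjDefect sandwichDefect)
open Summit.QuantumFields.BalabanUV.Beta.AxialDressingRooted (one_le_of_neZero)
open Summit.QuantumFields.BalabanUV.Beta.SymmetrisedDressingKernel (coDressKSymAt)
open Summit.QuantumFields.BalabanUV.Beta.AveragingWardRootedStencils (legInd)
open Summit.QuantumFields.BalabanUV.Beta.SymmetrisedStepJets (SymTables)
open Summit.QuantumFields.BalabanUV.Beta.CombChartStepJets (GcombSh ScombOf SpureCombOf JsB12CombSh0)
open Summit.QuantumFields.BalabanUV.Beta.SpineRooted (M1Of SpureRecOf T2RecOf WrecOf)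
open Summit.QuantumFields.BalabanUV.Beta.WardLocusRecursive (SrecOf)
open Summit.QuantumFields.BalabanUV.Beta.WardLocusCubic (mmSym)
open Summit.QuantumFields.BalabanUV.Beta.SymShiftedSpread (bhKStepSh)
open Summit.QuantumFields.BalabanUV.Beta.BorderedHessian (sgnK bhK stepScale diagK)
open Summit.QuantumFields.BalabanUV.Beta.E3ContactGenerator (ctGenM)
open Summit.QuantumFields.BalabanUV.Beta.DshAn1 (Dsh)
open Summit.QuantumFields.BalabanUV.Beta.SymAveragingHessianCounts (symVhSAt symHessFFAt)
open Summit.QuantumFields.BalabanUV.Beta.SymAveragingMixedJetTables (symMixFFAt)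
open Summit.QuantumFields.BalabanUV.Beta.SymSecondOrderTablesAn1 (symVh₂SAn1 symTablesAn1S2 locStencil₂_symVh₂SAn1 symVh₂SAn1_hBt symVh₂SAn1_inl_inl
  symMixFFAt_hmix_ctr symMixFFAt_hmixt)
open Summit.QuantumFields.BalabanUV.Beta.SymMixedReflectionLetterAn1 (symRMrAn1 hM2_symMixFFAt)

open Summit.QuantumFields.BalabanUV.Beta.E3LevelOneReflection (refK_smul refK_Φ_refK_Φ)
open ResolventReflection (reflSign_mul_self)

namespace Summit.QuantumFields.BalabanUV.Beta.CombSecondOrderRemainderAn1Scaled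

variable {Lc : ℕ} [NeZero Lc]

/-! ## §1 The three kernels the letters force, for the κ-literal -/

/-- [our object] **THE SPLIT DEFECT OF THE κ-LITERAL AT LEVEL `j` GIVEN THE LEVEL-`j` REMAINDER `Rj`** (`hsplit` solved for `Δ j`): the landed `combΔOfAt` with the
mixed table at weight `w`, the multiplier∕first-order pin `w·cΛ` and the mixed reflection remainder `w • symRMrAn1 Lc cΛ γ` (shape (S)); `w = 1` is the landed object by `one_smul`∕`one_mul`. -/
def combΔOfAtW (Lc : ℕ) [NeZero Lc] (N : ℕ) (cΛ w : ℝ) (γ : ℕ → ℝ) (X2s : ℕ → Fin 4 → Fin 4 → (Fin 4 → ℤ) → Fin 4 → (Fin 4 → ℤ) → (Fin 4 → ℤ) → Fib 3 → ℝ) (j : ℕ) (Rj : Fin 4 → Fin 4 → (Fin 4 → ℤ) → Fin 4 → (Fin 4 → ℤ) → MKer 4 (Fib 3)) :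
    Fin 4 → Fin 4 → (Fin 4 → ℤ) → Fin 4 → (Fin 4 → ℤ) → MKer 4 (Fib 3) := fun α μ y ν y' =>
  (W2OfK (GcombSh (d := 3) Lc j) Lc
          (fun κ u => SpureRecOf 3 Lc (symVhSAt (ctr 4 Lc) 3 Lc rfl) (symHessFFAt (ctr 4 Lc) Lc) (GcombSh Lc) ((Lc : ℝ) ^ 4) (-((Lc : ℝ) ^ 8 / 2)) (w * cΛ) j κ u + conjV (bhKStepSh 3 Lc (Dsh Lc) j) (diagK fun p c => γ j * ctGenM 3 (bhK Lc + Dsh Lc) α Lc κ u p c))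
          (M1Of 3 Lc (symHessFFAt (ctr 4 Lc) Lc) (w * cΛ) j)
          (fun κ u κ' u' => T2RecOf 3 Lc (GcombSh Lc) (SpureRecOf 3 Lc (symVhSAt (ctr 4 Lc) 3 Lc rfl) (symHessFFAt (ctr 4 Lc) Lc) (GcombSh Lc) ((Lc : ℝ) ^ 4) (-((Lc : ℝ) ^ 8 / 2)) (w * cΛ)) (M1Of 3 Lc (symHessFFAt (ctr 4 Lc) Lc) (w * cΛ)) ((Lc : ℝ) ^ 8) (-((Lc : ℝ) ^ 12 / 4)) ((8 * (N : ℝ) ^ 2)⁻¹ • wsym22 N) (symVh₂SAn1 3 Lc) (w • symMixFFAt (ctr 4 Lc) Lc) j κ u κ' u' +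
            conjW (bhKStepSh 3 Lc (Dsh Lc) j) (SpureRecOf 3 Lc (symVhSAt (ctr 4 Lc) 3 Lc rfl) (symHessFFAt (ctr 4 Lc) Lc) (GcombSh Lc) ((Lc : ℝ) ^ 4) (-((Lc : ℝ) ^ 8 / 2)) (w * cΛ) j κ u) (SpureRecOf 3 Lc (symVhSAt (ctr 4 Lc) 3 Lc rfl) (symHessFFAt (ctr 4 Lc) Lc) (GcombSh Lc) ((Lc : ℝ) ^ 4) (-((Lc : ℝ) ^ 8 / 2)) (w * cΛ) j κ' u')
              (diagK fun p c => γ j * ctGenM 3 (bhK Lc + Dsh Lc) α Lc κ u p c) (diagK fun p c => γ j * ctGenM 3 (bhK Lc + Dsh Lc) α Lc κ' u' p c) (diagK fun p c => (γ j * ctGenM 3 (bhK Lc + Dsh Lc) α Lc κ u p c) * (γ j * ctGenM 3 (bhK Lc + Dsh Lc) α Lc κ' u' p c)) +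
            Rj α κ u κ' u')
          (fun κ u ρ t => M2Of 3 Lc (w • symMixFFAt (ctr 4 Lc) Lc) j κ u ρ t + conjV (M1Of 3 Lc (symHessFFAt (ctr 4 Lc) Lc) (w * cΛ) j ρ t) (diagK fun p c => γ j * ctGenM 3 (bhK Lc + Dsh Lc) α Lc κ u p c) + w • symRMrAn1 Lc cΛ γ j α κ u ρ t)
          μ y ν y') -
    (W2OfK (GcombSh (d := 3) Lc j) Lc (SpureRecOf 3 Lc (symVhSAt (ctr 4 Lc) 3 Lc rfl) (symHessFFAt (ctr 4 Lc) Lc) (GcombSh Lc) ((Lc : ℝ) ^ 4) (-((Lc : ℝ) ^ 8 / 2)) (w * cΛ) j) (M1Of 3 Lc (symHessFFAt (ctr 4 Lc) Lc) (w * cΛ) j)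
            (T2RecOf 3 Lc (GcombSh Lc) (SpureRecOf 3 Lc (symVhSAt (ctr 4 Lc) 3 Lc rfl) (symHessFFAt (ctr 4 Lc) Lc) (GcombSh Lc) ((Lc : ℝ) ^ 4) (-((Lc : ℝ) ^ 8 / 2)) (w * cΛ)) (M1Of 3 Lc (symHessFFAt (ctr 4 Lc) Lc) (w * cΛ)) ((Lc : ℝ) ^ 8) (-((Lc : ℝ) ^ 12 / 4)) ((8 * (N : ℝ) ^ 2)⁻¹ • wsym22 N) (symVh₂SAn1 3 Lc) (w • symMixFFAt (ctr 4 Lc) Lc) j)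
            (M2Of 3 Lc (w • symMixFFAt (ctr 4 Lc) Lc) j) μ y ν y' +
          conjW (bhKStepSh 3 Lc (Dsh Lc) j)
            (dM (GcombSh Lc j) Lc (SpureRecOf 3 Lc (symVhSAt (ctr 4 Lc) 3 Lc rfl) (symHessFFAt (ctr 4 Lc) Lc) (GcombSh Lc) ((Lc : ℝ) ^ 4) (-((Lc : ℝ) ^ 8 / 2)) (w * cΛ) j) (M1Of 3 Lc (symHessFFAt (ctr 4 Lc) Lc) (w * cΛ) j) μ y)
            (dM (GcombSh Lc j) Lc (SpureRecOf 3 Lc (symVhSAt (ctr 4 Lc) 3 Lc rfl) (symHessFFAt (ctr 4 Lc) Lc) (GcombSh Lc) ((Lc : ℝ) ^ 4) (-((Lc : ℝ) ^ 8 / 2)) (w * cΛ) j) (M1Of 3 Lc (symHessFFAt (ctr 4 Lc) Lc) (w * cΛ) j) ν y')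
            (diagK fun p c => ∑ κ, ∑' u, colH (GcombSh Lc j) Lc μ y κ u * (γ j * ctGenM 3 (bhK Lc + Dsh Lc) α Lc κ u p c))
            (diagK fun p c => ∑ κ, ∑' u, colH (GcombSh Lc j) Lc ν y' κ u * (γ j * ctGenM 3 (bhK Lc + Dsh Lc) α Lc κ u p c))
            (diagK (X2s j α μ y ν y')))

/-- [our object] **THE SECOND-ORDER REMAINDER OF THE κ-LITERAL ROOT, EVERY LEVEL** (`h0` solved for `R2 0`; `hR2succ` as the recursion step) — the landed
`combR2An1` with the three (S) substitutions; a recursively DEFINED object (affine, not homogeneous, in `w` through the pin-generic words), NOT `w •` the landed one. -/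
def combR2An1W (Lc : ℕ) [NeZero Lc] (N : ℕ) (cΛ w : ℝ) (γ : ℕ → ℝ) (X2s : ℕ → Fin 4 → Fin 4 → (Fin 4 → ℤ) → Fin 4 → (Fin 4 → ℤ) → (Fin 4 → ℤ) → Fib 3 → ℝ) : ℕ → Fin 4 → Fin 4 → (Fin 4 → ℤ) → Fin 4 → (Fin 4 → ℤ) → MKer 4 (Fib 3)
  | 0 => fun α κ u κ' u' =>
      (reflSign α κ * reflSign α κ') • refK (Φ Lc α) (T2RecOf 3 Lc (GcombSh Lc) (SpureRecOf 3 Lc (symVhSAt (ctr 4 Lc) 3 Lc rfl) (symHessFFAt (ctr 4 Lc) Lc) (GcombSh Lc) ((Lc : ℝ) ^ 4) (-((Lc : ℝ) ^ 8 / 2)) (w * cΛ)) (M1Of 3 Lc (symHessFFAt (ctr 4 Lc) Lc) (w * cΛ)) ((Lc : ℝ) ^ 8) (-((Lc : ℝ) ^ 12 / 4)) ((8 * (N : ℝ) ^ 2)⁻¹ • wsym22 N) (symVh₂SAn1 3 Lc) (w • symMixFFAt (ctr 4 Lc) Lc) 0 κ (bref α κ u) κ' (bref α κ' u')) -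
        T2RecOf 3 Lc (GcombSh Lc) (SpureRecOf 3 Lc (symVhSAt (ctr 4 Lc) 3 Lc rfl) (symHessFFAt (ctr 4 Lc) Lc) (GcombSh Lc) ((Lc : ℝ) ^ 4) (-((Lc : ℝ) ^ 8 / 2)) (w * cΛ)) (M1Of 3 Lc (symHessFFAt (ctr 4 Lc) Lc) (w * cΛ)) ((Lc : ℝ) ^ 8) (-((Lc : ℝ) ^ 12 / 4)) ((8 * (N : ℝ) ^ 2)⁻¹ • wsym22 N) (symVh₂SAn1 3 Lc) (w • symMixFFAt (ctr 4 Lc) Lc) 0 κ u κ' u' -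
        conjW (bhKStepSh 3 Lc (Dsh Lc) 0) (SpureRecOf 3 Lc (symVhSAt (ctr 4 Lc) 3 Lc rfl) (symHessFFAt (ctr 4 Lc) Lc) (GcombSh Lc) ((Lc : ℝ) ^ 4) (-((Lc : ℝ) ^ 8 / 2)) (w * cΛ) 0 κ u) (SpureRecOf 3 Lc (symVhSAt (ctr 4 Lc) 3 Lc rfl) (symHessFFAt (ctr 4 Lc) Lc) (GcombSh Lc) ((Lc : ℝ) ^ 4) (-((Lc : ℝ) ^ 8 / 2)) (w * cΛ) 0 κ' u')
              (diagK fun p c => γ 0 * ctGenM 3 (bhK Lc + Dsh Lc) α Lc κ u p c) (diagK fun p c => γ 0 * ctGenM 3 (bhK Lc + Dsh Lc) α Lc κ' u' p c) (diagK fun p c => (γ 0 * ctGenM 3 (bhK Lc + Dsh Lc) α Lc κ u p c) * (γ 0 * ctGenM 3 (bhK Lc + Dsh Lc) α Lc κ' u' p c))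
  | j + 1 => fun α κ u κ' u' =>
          (-((((Lc : ℝ) ^ 8) * wV4 3 Lc (j + 1)) • mmRead Lc
              (comp (comp (GcombSh Lc j) (((1 / 2 : ℝ) • conjV (bhKStepSh 3 Lc (Dsh Lc) j) (diagK fun p a => X2s j α κ' u' κ u p a - X2s j α κ u κ' u' p a) +
                (1 / 2 : ℝ) • (combΔOfAtW Lc N cΛ w γ X2s j (combR2An1W Lc N cΛ w γ X2s j) α κ u κ' u' + combΔOfAtW Lc N cΛ w γ X2s j (combR2An1W Lc N cΛ w γ X2s j) α κ' u' κ u)))) (GcombSh Lc j) -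
                (comp (sandwichDefect (GcombSh Lc j) (bhKStepSh 3 Lc (Dsh Lc) j)
                      (diagK fun p c => ∑ ι, ∑' v, colH (GcombSh Lc j) Lc κ u ι v * (γ j * ctGenM 3 (bhK Lc + Dsh Lc) α Lc ι v p c)))
                    (comp (dM (GcombSh Lc j) Lc (SpureRecOf 3 Lc (symVhSAt (ctr 4 Lc) 3 Lc rfl) (symHessFFAt (ctr 4 Lc) Lc) (GcombSh Lc) ((Lc : ℝ) ^ 4) (-((Lc : ℝ) ^ 8 / 2)) (w * cΛ) j) (M1Of 3 Lc (symHessFFAt (ctr 4 Lc) Lc) (w * cΛ) j) κ' u') (GcombSh Lc j) -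
                      diagK fun p c => ∑ ι, ∑' v, colH (GcombSh Lc j) Lc κ' u' ι v * (γ j * ctGenM 3 (bhK Lc + Dsh Lc) α Lc ι v p c))
                  + comp (comp (GcombSh Lc j) (dM (GcombSh Lc j) Lc (SpureRecOf 3 Lc (symVhSAt (ctr 4 Lc) 3 Lc rfl) (symHessFFAt (ctr 4 Lc) Lc) (GcombSh Lc) ((Lc : ℝ) ^ 4) (-((Lc : ℝ) ^ 8 / 2)) (w * cΛ) j) (M1Of 3 Lc (symHessFFAt (ctr 4 Lc) Lc) (w * cΛ) j) κ u +
                      conjV (bhKStepSh 3 Lc (Dsh Lc) j) (diagK fun p c => ∑ ι, ∑' v, colH (GcombSh Lc j) Lc κ u ι v * (γ j * ctGenM 3 (bhK Lc + Dsh Lc) α Lc ι v p c))))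
                    (sandwichDefect (GcombSh Lc j) (bhKStepSh 3 Lc (Dsh Lc) j)
                      (diagK fun p c => ∑ ι, ∑' v, colH (GcombSh Lc j) Lc κ' u' ι v * (γ j * ctGenM 3 (bhK Lc + Dsh Lc) α Lc ι v p c)))
                  + comp (sandwichDefect (GcombSh Lc j) (bhKStepSh 3 Lc (Dsh Lc) j)
                      (diagK fun p c => ∑ ι, ∑' v, colH (GcombSh Lc j) Lc κ' u' ι v * (γ j * ctGenM 3 (bhK Lc + Dsh Lc) α Lc ι v p c)))
                    (comp (dM (GcombSh Lc j) Lc (SpureRecOf 3 Lc (symVhSAt (ctr 4 Lc) 3 Lc rfl) (symHessFFAt (ctr 4 Lc) Lc) (GcombSh Lc) ((Lc : ℝ) ^ 4) (-((Lc : ℝ) ^ 8 / 2)) (w * cΛ) j) (M1Of 3 Lc (symHessFFAt (ctr 4 Lc) Lc) (w * cΛ) j) κ u) (GcombSh Lc j) -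
                      diagK fun p c => ∑ ι, ∑' v, colH (GcombSh Lc j) Lc κ u ι v * (γ j * ctGenM 3 (bhK Lc + Dsh Lc) α Lc ι v p c))
                  + comp (comp (GcombSh Lc j) (dM (GcombSh Lc j) Lc (SpureRecOf 3 Lc (symVhSAt (ctr 4 Lc) 3 Lc rfl) (symHessFFAt (ctr 4 Lc) Lc) (GcombSh Lc) ((Lc : ℝ) ^ 4) (-((Lc : ℝ) ^ 8 / 2)) (w * cΛ) j) (M1Of 3 Lc (symHessFFAt (ctr 4 Lc) Lc) (w * cΛ) j) κ' u' +
                      conjV (bhKStepSh 3 Lc (Dsh Lc) j) (diagK fun p c => ∑ ι, ∑' v, colH (GcombSh Lc j) Lc κ' u' ι v * (γ j * ctGenM 3 (bhK Lc + Dsh Lc) α Lc ι v p c))))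
                    (sandwichDefect (GcombSh Lc j) (bhKStepSh 3 Lc (Dsh Lc) j)
                      (diagK fun p c => ∑ ι, ∑' v, colH (GcombSh Lc j) Lc κ u ι v * (γ j * ctGenM 3 (bhK Lc + Dsh Lc) α Lc ι v p c)))))) +
            (0 : ℕ → Fin 4 → Fin 4 → (Fin 4 → ℤ) → Fin 4 → (Fin 4 → ℤ) → MKer 4 (Fib 3)) (j + 1) α κ u κ' u' +
            conjV (mmRead Lc (GcombSh (d := 3) Lc j))
              (diagK fun p c => ((Lc : ℝ) ^ 8) * wV4 3 Lc (j + 1) * mmSym Lc (X2s j α κ u κ' u') p c - wVH 3 Lc (j + 1) * ((γ (j + 1) * ctGenM 3 (bhK Lc + Dsh Lc) α Lc κ u p c) * (γ (j + 1) * ctGenM 3 (bhK Lc + Dsh Lc) α Lc κ' u' p c))))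

/-- [our object] **THE SPLIT DEFECT OF THE κ-LITERAL ROOT, EVERY LEVEL**: `combΔOfAtW … j (combR2An1W … j)`. -/
def combΔAn1W (Lc : ℕ) [NeZero Lc] (N : ℕ) (cΛ w : ℝ) (γ : ℕ → ℝ) (X2s : ℕ → Fin 4 → Fin 4 → (Fin 4 → ℤ) → Fin 4 → (Fin 4 → ℤ) → (Fin 4 → ℤ) → Fib 3 → ℝ) : ℕ → Fin 4 → Fin 4 → (Fin 4 → ℤ) → Fin 4 → (Fin 4 → ℤ) → MKer 4 (Fib 3) :=
  fun j => combΔOfAtW Lc N cΛ w γ X2s j (combR2An1W Lc N cΛ w γ X2s j)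

/-! ## §2 The three bookkeeping letters of the κ-literal, by construction -/

variable (N : ℕ) (cΛ w : ℝ) (γ : ℕ → ℝ) (X2s : ℕ → Fin 4 → Fin 4 → (Fin 4 → ℤ) → Fin 4 → (Fin 4 → ℤ) → (Fin 4 → ℤ) → Fib 3 → ℝ)

/-- [folklore] **THE BINDER `hR2succ` OF THE κ-LITERAL CHAIN at `R2 := combR2An1W …`, `Δ := combΔAn1W …` — by `rfl`** (the recursion step IS the definition). -/
theorem hR2succ_combW :
    ∀ (j : ℕ) (α κ : Fin 4) (u : Fin 4 → ℤ) (κ' : Fin 4) (u' : Fin 4 → ℤ),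
      combR2An1W Lc N cΛ w γ X2s (j + 1) α κ u κ' u' =
          (-((((Lc : ℝ) ^ 8) * wV4 3 Lc (j + 1)) • mmRead Lc
              (comp (comp (GcombSh Lc j) (((1 / 2 : ℝ) • conjV (bhKStepSh 3 Lc (Dsh Lc) j) (diagK fun p a => X2s j α κ' u' κ u p a - X2s j α κ u κ' u' p a) +
                (1 / 2 : ℝ) • (combΔAn1W Lc N cΛ w γ X2s j α κ u κ' u' + combΔAn1W Lc N cΛ w γ X2s j α κ' u' κ u)))) (GcombSh Lc j) -
                (comp (sandwichDefect (GcombSh Lc j) (bhKStepSh 3 Lc (Dsh Lc) j)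
                      (diagK fun p c => ∑ ι, ∑' v, colH (GcombSh Lc j) Lc κ u ι v * (γ j * ctGenM 3 (bhK Lc + Dsh Lc) α Lc ι v p c)))
                    (comp (dM (GcombSh Lc j) Lc (SpureRecOf 3 Lc (symVhSAt (ctr 4 Lc) 3 Lc rfl) (symHessFFAt (ctr 4 Lc) Lc) (GcombSh Lc) ((Lc : ℝ) ^ 4) (-((Lc : ℝ) ^ 8 / 2)) (w * cΛ) j) (M1Of 3 Lc (symHessFFAt (ctr 4 Lc) Lc) (w * cΛ) j) κ' u') (GcombSh Lc j) -
                      diagK fun p c => ∑ ι, ∑' v, colH (GcombSh Lc j) Lc κ' u' ι v * (γ j * ctGenM 3 (bhK Lc + Dsh Lc) α Lc ι v p c))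
                  + comp (comp (GcombSh Lc j) (dM (GcombSh Lc j) Lc (SpureRecOf 3 Lc (symVhSAt (ctr 4 Lc) 3 Lc rfl) (symHessFFAt (ctr 4 Lc) Lc) (GcombSh Lc) ((Lc : ℝ) ^ 4) (-((Lc : ℝ) ^ 8 / 2)) (w * cΛ) j) (M1Of 3 Lc (symHessFFAt (ctr 4 Lc) Lc) (w * cΛ) j) κ u +
                      conjV (bhKStepSh 3 Lc (Dsh Lc) j) (diagK fun p c => ∑ ι, ∑' v, colH (GcombSh Lc j) Lc κ u ι v * (γ j * ctGenM 3 (bhK Lc + Dsh Lc) α Lc ι v p c))))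
                    (sandwichDefect (GcombSh Lc j) (bhKStepSh 3 Lc (Dsh Lc) j)
                      (diagK fun p c => ∑ ι, ∑' v, colH (GcombSh Lc j) Lc κ' u' ι v * (γ j * ctGenM 3 (bhK Lc + Dsh Lc) α Lc ι v p c)))
                  + comp (sandwichDefect (GcombSh Lc j) (bhKStepSh 3 Lc (Dsh Lc) j)
                      (diagK fun p c => ∑ ι, ∑' v, colH (GcombSh Lc j) Lc κ' u' ι v * (γ j * ctGenM 3 (bhK Lc + Dsh Lc) α Lc ι v p c)))
                    (comp (dM (GcombSh Lc j) Lc (SpureRecOf 3 Lc (symVhSAt (ctr 4 Lc) 3 Lc rfl) (symHessFFAt (ctr 4 Lc) Lc) (GcombSh Lc) ((Lc : ℝ) ^ 4) (-((Lc : ℝ) ^ 8 / 2)) (w * cΛ) j) (M1Of 3 Lc (symHessFFAt (ctr 4 Lc) Lc) (w * cΛ) j) κ u) (GcombSh Lc j) -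
                      diagK fun p c => ∑ ι, ∑' v, colH (GcombSh Lc j) Lc κ u ι v * (γ j * ctGenM 3 (bhK Lc + Dsh Lc) α Lc ι v p c))
                  + comp (comp (GcombSh Lc j) (dM (GcombSh Lc j) Lc (SpureRecOf 3 Lc (symVhSAt (ctr 4 Lc) 3 Lc rfl) (symHessFFAt (ctr 4 Lc) Lc) (GcombSh Lc) ((Lc : ℝ) ^ 4) (-((Lc : ℝ) ^ 8 / 2)) (w * cΛ) j) (M1Of 3 Lc (symHessFFAt (ctr 4 Lc) Lc) (w * cΛ) j) κ' u' +
                      conjV (bhKStepSh 3 Lc (Dsh Lc) j) (diagK fun p c => ∑ ι, ∑' v, colH (GcombSh Lc j) Lc κ' u' ι v * (γ j * ctGenM 3 (bhK Lc + Dsh Lc) α Lc ι v p c))))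
                    (sandwichDefect (GcombSh Lc j) (bhKStepSh 3 Lc (Dsh Lc) j)
                      (diagK fun p c => ∑ ι, ∑' v, colH (GcombSh Lc j) Lc κ u ι v * (γ j * ctGenM 3 (bhK Lc + Dsh Lc) α Lc ι v p c)))))) +
            (0 : ℕ → Fin 4 → Fin 4 → (Fin 4 → ℤ) → Fin 4 → (Fin 4 → ℤ) → MKer 4 (Fib 3)) (j + 1) α κ u κ' u' +
            conjV (mmRead Lc (GcombSh (d := 3) Lc j))
              (diagK fun p c => ((Lc : ℝ) ^ 8) * wV4 3 Lc (j + 1) * mmSym Lc (X2s j α κ u κ' u') p c - wVH 3 Lc (j + 1) * ((γ (j + 1) * ctGenM 3 (bhK Lc + Dsh Lc) α Lc κ u p c) * (γ (j + 1) * ctGenM 3 (bhK Lc + Dsh Lc) α Lc κ' u' p c)))) :=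
  fun _ _ _ _ _ _ => rfl

/-- [folklore] **THE BINDER `hsplit` OF THE κ-LITERAL CHAIN at `R2 := combR2An1W …`, `Δ := combΔAn1W …` — by `add_sub_cancel`** (the defect IS the difference). -/
theorem hsplit_combW :
    ∀ (j : ℕ) (α μ : Fin 4) (y : Fin 4 → ℤ) (ν : Fin 4) (y' : Fin 4 → ℤ),
      W2OfK (GcombSh (d := 3) Lc j) Lc
          (fun κ u => SpureRecOf 3 Lc (symVhSAt (ctr 4 Lc) 3 Lc rfl) (symHessFFAt (ctr 4 Lc) Lc) (GcombSh Lc) ((Lc : ℝ) ^ 4) (-((Lc : ℝ) ^ 8 / 2)) (w * cΛ) j κ u + conjV (bhKStepSh 3 Lc (Dsh Lc) j) (diagK fun p c => γ j * ctGenM 3 (bhK Lc + Dsh Lc) α Lc κ u p c))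
          (M1Of 3 Lc (symHessFFAt (ctr 4 Lc) Lc) (w * cΛ) j)
          (fun κ u κ' u' => T2RecOf 3 Lc (GcombSh Lc) (SpureRecOf 3 Lc (symVhSAt (ctr 4 Lc) 3 Lc rfl) (symHessFFAt (ctr 4 Lc) Lc) (GcombSh Lc) ((Lc : ℝ) ^ 4) (-((Lc : ℝ) ^ 8 / 2)) (w * cΛ)) (M1Of 3 Lc (symHessFFAt (ctr 4 Lc) Lc) (w * cΛ)) ((Lc : ℝ) ^ 8) (-((Lc : ℝ) ^ 12 / 4)) ((8 * (N : ℝ) ^ 2)⁻¹ • wsym22 N) (symVh₂SAn1 3 Lc) (w • symMixFFAt (ctr 4 Lc) Lc) j κ u κ' u' +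
            conjW (bhKStepSh 3 Lc (Dsh Lc) j) (SpureRecOf 3 Lc (symVhSAt (ctr 4 Lc) 3 Lc rfl) (symHessFFAt (ctr 4 Lc) Lc) (GcombSh Lc) ((Lc : ℝ) ^ 4) (-((Lc : ℝ) ^ 8 / 2)) (w * cΛ) j κ u) (SpureRecOf 3 Lc (symVhSAt (ctr 4 Lc) 3 Lc rfl) (symHessFFAt (ctr 4 Lc) Lc) (GcombSh Lc) ((Lc : ℝ) ^ 4) (-((Lc : ℝ) ^ 8 / 2)) (w * cΛ) j κ' u')
              (diagK fun p c => γ j * ctGenM 3 (bhK Lc + Dsh Lc) α Lc κ u p c) (diagK fun p c => γ j * ctGenM 3 (bhK Lc + Dsh Lc) α Lc κ' u' p c) (diagK fun p c => (γ j * ctGenM 3 (bhK Lc + Dsh Lc) α Lc κ u p c) * (γ j * ctGenM 3 (bhK Lc + Dsh Lc) α Lc κ' u' p c)) +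
            combR2An1W Lc N cΛ w γ X2s j α κ u κ' u')
          (fun κ u ρ t => M2Of 3 Lc (w • symMixFFAt (ctr 4 Lc) Lc) j κ u ρ t + conjV (M1Of 3 Lc (symHessFFAt (ctr 4 Lc) Lc) (w * cΛ) j ρ t) (diagK fun p c => γ j * ctGenM 3 (bhK Lc + Dsh Lc) α Lc κ u p c) + w • symRMrAn1 Lc cΛ γ j α κ u ρ t)
          μ y ν y' =
        W2OfK (GcombSh (d := 3) Lc j) Lc (SpureRecOf 3 Lc (symVhSAt (ctr 4 Lc) 3 Lc rfl) (symHessFFAt (ctr 4 Lc) Lc) (GcombSh Lc) ((Lc : ℝ) ^ 4) (-((Lc : ℝ) ^ 8 / 2)) (w * cΛ) j) (M1Of 3 Lc (symHessFFAt (ctr 4 Lc) Lc) (w * cΛ) j)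
            (T2RecOf 3 Lc (GcombSh Lc) (SpureRecOf 3 Lc (symVhSAt (ctr 4 Lc) 3 Lc rfl) (symHessFFAt (ctr 4 Lc) Lc) (GcombSh Lc) ((Lc : ℝ) ^ 4) (-((Lc : ℝ) ^ 8 / 2)) (w * cΛ)) (M1Of 3 Lc (symHessFFAt (ctr 4 Lc) Lc) (w * cΛ)) ((Lc : ℝ) ^ 8) (-((Lc : ℝ) ^ 12 / 4)) ((8 * (N : ℝ) ^ 2)⁻¹ • wsym22 N) (symVh₂SAn1 3 Lc) (w • symMixFFAt (ctr 4 Lc) Lc) j)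
            (M2Of 3 Lc (w • symMixFFAt (ctr 4 Lc) Lc) j) μ y ν y' +
          conjW (bhKStepSh 3 Lc (Dsh Lc) j)
            (dM (GcombSh Lc j) Lc (SpureRecOf 3 Lc (symVhSAt (ctr 4 Lc) 3 Lc rfl) (symHessFFAt (ctr 4 Lc) Lc) (GcombSh Lc) ((Lc : ℝ) ^ 4) (-((Lc : ℝ) ^ 8 / 2)) (w * cΛ) j) (M1Of 3 Lc (symHessFFAt (ctr 4 Lc) Lc) (w * cΛ) j) μ y)
            (dM (GcombSh Lc j) Lc (SpureRecOf 3 Lc (symVhSAt (ctr 4 Lc) 3 Lc rfl) (symHessFFAt (ctr 4 Lc) Lc) (GcombSh Lc) ((Lc : ℝ) ^ 4) (-((Lc : ℝ) ^ 8 / 2)) (w * cΛ) j) (M1Of 3 Lc (symHessFFAt (ctr 4 Lc) Lc) (w * cΛ) j) ν y')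
            (diagK fun p c => ∑ κ, ∑' u, colH (GcombSh Lc j) Lc μ y κ u * (γ j * ctGenM 3 (bhK Lc + Dsh Lc) α Lc κ u p c))
            (diagK fun p c => ∑ κ, ∑' u, colH (GcombSh Lc j) Lc ν y' κ u * (γ j * ctGenM 3 (bhK Lc + Dsh Lc) α Lc κ u p c))
            (diagK (X2s j α μ y ν y')) +
          combΔAn1W Lc N cΛ w γ X2s j α μ y ν y' :=
  fun _ _ _ _ _ _ => (add_sub_cancel _ _).symm

/-- [folklore] **THE BINDER `h0` OF THE κ-LITERAL CHAIN at `R2 := combR2An1W …` — by the involution `refK (Φ Lc α) ∘ refK (Φ Lc α) = id` and `(ε_κε_κ′)² = 1`.** -/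
theorem h0_combW :
    ∀ (α κ : Fin 4) (u : Fin 4 → ℤ) (κ' : Fin 4) (u' : Fin 4 → ℤ),
      T2RecOf 3 Lc (GcombSh Lc) (SpureRecOf 3 Lc (symVhSAt (ctr 4 Lc) 3 Lc rfl) (symHessFFAt (ctr 4 Lc) Lc) (GcombSh Lc) ((Lc : ℝ) ^ 4) (-((Lc : ℝ) ^ 8 / 2)) (w * cΛ)) (M1Of 3 Lc (symHessFFAt (ctr 4 Lc) Lc) (w * cΛ)) ((Lc : ℝ) ^ 8) (-((Lc : ℝ) ^ 12 / 4)) ((8 * (N : ℝ) ^ 2)⁻¹ • wsym22 N) (symVh₂SAn1 3 Lc) (w • symMixFFAt (ctr 4 Lc) Lc) 0 κ (bref α κ u) κ' (bref α κ' u') =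
        (reflSign α κ * reflSign α κ') • refK (Φ Lc α)
          (T2RecOf 3 Lc (GcombSh Lc) (SpureRecOf 3 Lc (symVhSAt (ctr 4 Lc) 3 Lc rfl) (symHessFFAt (ctr 4 Lc) Lc) (GcombSh Lc) ((Lc : ℝ) ^ 4) (-((Lc : ℝ) ^ 8 / 2)) (w * cΛ)) (M1Of 3 Lc (symHessFFAt (ctr 4 Lc) Lc) (w * cΛ)) ((Lc : ℝ) ^ 8) (-((Lc : ℝ) ^ 12 / 4)) ((8 * (N : ℝ) ^ 2)⁻¹ • wsym22 N) (symVh₂SAn1 3 Lc) (w • symMixFFAt (ctr 4 Lc) Lc) 0 κ u κ' u' +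
            conjW (bhKStepSh 3 Lc (Dsh Lc) 0) (SpureRecOf 3 Lc (symVhSAt (ctr 4 Lc) 3 Lc rfl) (symHessFFAt (ctr 4 Lc) Lc) (GcombSh Lc) ((Lc : ℝ) ^ 4) (-((Lc : ℝ) ^ 8 / 2)) (w * cΛ) 0 κ u) (SpureRecOf 3 Lc (symVhSAt (ctr 4 Lc) 3 Lc rfl) (symHessFFAt (ctr 4 Lc) Lc) (GcombSh Lc) ((Lc : ℝ) ^ 4) (-((Lc : ℝ) ^ 8 / 2)) (w * cΛ) 0 κ' u')
              (diagK fun p c => γ 0 * ctGenM 3 (bhK Lc + Dsh Lc) α Lc κ u p c) (diagK fun p c => γ 0 * ctGenM 3 (bhK Lc + Dsh Lc) α Lc κ' u' p c) (diagK fun p c => (γ 0 * ctGenM 3 (bhK Lc + Dsh Lc) α Lc κ u p c) * (γ 0 * ctGenM 3 (bhK Lc + Dsh Lc) α Lc κ' u' p c)) +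
            combR2An1W Lc N cΛ w γ X2s 0 α κ u κ' u') := by
  intro α κ u κ' u'
  have he : (reflSign α κ * reflSign α κ') * (reflSign α κ * reflSign α κ') = 1 := by
    rw [show (reflSign α κ * reflSign α κ') * (reflSign α κ * reflSign α κ') = (reflSign α κ * reflSign α κ) * (reflSign α κ' * reflSign α κ') by ring,
      reflSign_mul_self, reflSign_mul_self, one_mul]
  have key : ∀ (A C X : MKer 4 (Fib 3)) (e : ℝ), e * e = 1 →
      X = e • refK (Φ (d := 3) Lc α) (A + C + (e • refK (Φ (d := 3) Lc α) X - A - C)) := by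
    intro A C X e hee
    rw [show A + C + (e • refK (Φ (d := 3) Lc α) X - A - C) = e • refK (Φ (d := 3) Lc α) X by abel, refK_smul, refK_Φ_refK_Φ, smul_smul, hee,
      one_smul]
  exact key _ _ _ _ he

/-! ## §3 Weight one is the landed (III′) supply -/

/-- [folklore] **AT `w = 1` THE SPLIT-DEFECT FUNCTIONAL IS THE LANDED ONE**: `combΔOfAtW Lc N cΛ 1 γ X2s j Rj = combΔOfAt Lc N cΛ γ X2s j Rj` (`one_smul`, `one_mul`). -/
theorem combΔOfAtW_one (j : ℕ) (Rj : Fin 4 → Fin 4 → (Fin 4 → ℤ) → Fin 4 → (Fin 4 → ℤ) → MKer 4 (Fib 3)) :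
    combΔOfAtW Lc N cΛ 1 γ X2s j Rj = CombSecondOrderRemainderAn1.combΔOfAt Lc N cΛ γ X2s j Rj := by
  unfold combΔOfAtW CombSecondOrderRemainderAn1.combΔOfAt
  simp only [one_smul, one_mul]

/-- [folklore] **AT `w = 1` THE SECOND-ORDER REMAINDER IS THE LANDED ONE**: `combR2An1W Lc N cΛ 1 γ X2s j = combR2An1 Lc N cΛ γ X2s j`, every level
(induction on the level; `one_smul`, `one_mul`, §3's first lemma). -/
theorem combR2An1W_one : ∀ j : ℕ, combR2An1W Lc N cΛ 1 γ X2s j = CombSecondOrderRemainderAn1.combR2An1 Lc N cΛ γ X2s j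
  | 0 => by
    funext α κ u κ' u'
    simp only [combR2An1W, CombSecondOrderRemainderAn1.combR2An1, one_smul, one_mul]
  | j + 1 => by
    funext α κ u κ' u'
    rw [combR2An1W, CombSecondOrderRemainderAn1.combR2An1, combΔOfAtW_one, combR2An1W_one j]
    simp only [one_mul]

/-- [folklore] **AT `w = 1` THE SPLIT DEFECT IS THE LANDED ONE**: `combΔAn1W Lc N cΛ 1 γ X2s = combΔAn1 Lc N cΛ γ X2s`. -/
theorem combΔAn1W_one : combΔAn1W Lc N cΛ 1 γ X2s = CombSecondOrderRemainderAn1.combΔAn1 Lc N cΛ γ X2s := by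
  funext j
  show combΔOfAtW Lc N cΛ 1 γ X2s j (combR2An1W Lc N cΛ 1 γ X2s j) = CombSecondOrderRemainderAn1.combΔOfAt Lc N cΛ γ X2s j (CombSecondOrderRemainderAn1.combR2An1 Lc N cΛ γ X2s j)
  rw [combR2An1W_one, combΔOfAtW_one]

end Summit.QuantumFields.BalabanUV.Beta.CombSecondOrderRemainderAn1Scaled

end
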